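import Literature.RingTheory.FormalGroups.FormalOModuleBudAddCocycle
import Literature.RingTheory.FormalGroups.DrinfeldCocycleLift
import HarnessLib

/-!
# Buds of formal `𝒪`-module laws, XI: descent of bud extensions along an injective base change `P ↪ Q`
# ([Lazard 1955] §III (proof of Thm. II via `A ⊂ A ⊗ ℚ`); [Drinfeld 1974] §1, proof of Prop. 1.4)

Topic `Literature/RingTheory/FormalGroups`; namespace `Literature.RingTheory.FormalGroups`.  Fully proved theorems; no
definition, no named fact, no instance, no notation, no `sorry`.  Cell `hodgecm-mathlib`, P6 «MOD programme», sub-line P6d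
(power-series layer for `stub_L4B3cO`).

THE TORSION-FREE STEP of Lazard's ∕ Drinfeld's structure theorem, in bud form.  Let `ι : P ↪ Q` be an injective map of
`𝒪`-algebras such that `k`-buds over `Q` extend to `(k+1)`-buds (e.g. `Q = P ⊗ K`, sibling `FormalOModuleBudExtension`), and
let `𝒪` be a DVR with finite residue field of characteristic `p` (so that Drinfeld cocycles lift along `Q ↠ Q/ι(P)`,
★ `IsDrinfeldCocycle.exists_lift`).  Then every `k`-bud over `P` (`k ≥ 1`) extends to a `(k+1)`-bud over `P`
(`IsOModuleBud.exists_extend_of_injective`): extend over `Q`; the degree-`(k+1)` discrepancy with the base, read in the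
`𝒪`-module `Q/ι(P)`, is a bud relation (★ `IsOModuleBud.isBudRelation_of_sub`), hence a Drinfeld cocycle, which lifts to `Q`
and is subtracted (★ `IsOModuleBud.add_cocycle`); the corrected extension has coefficients in `ι(P)` up to degree `k+1` and
descends (`exists_map_sub_le_order`).
-/

noncomputable section

namespace Literature.RingTheory.FormalGroups

open MvPowerSeries (HasSubst subst X order coeff)
open Finset Finsupp

universe u v w

variable {𝒪 : Type u} [CommRing 𝒪]

/-! ## §1 Descending a series along `ι` up to a given degree -/

/-- **Descent of coefficients.**  If the coefficients of `G ∈ Q⟦X⟧` of degree `< N` lie in `ι(P)`, there is `g ∈ P⟦X⟧` with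
`ι_* g ≡ G (mod deg N)`. [cite: Lazard1955, §III] -/
theorem exists_map_sub_le_order {P : Type v} {Q : Type w} [CommRing P] [CommRing Q] {τ : Type*} (ι : P →+* Q)
    (G : MvPowerSeries τ Q) (N : ℕ) (h : ∀ d : τ →₀ ℕ, d.degree < N → coeff d G ∈ Set.range ι) :
    ∃ g : MvPowerSeries τ P, (N : ℕ∞) ≤ (MvPowerSeries.map ι g - G).order := by
  classical
  refine ⟨fun d => if hd : coeff d G ∈ Set.range ι then Classical.choose hd else 0, ?_⟩
  rw [natCast_le_order_sub_iff]
  intro d hd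
  rw [MvPowerSeries.coeff_map]
  change ι ((fun d => if hd : coeff d G ∈ Set.range ι then Classical.choose hd else 0) d) = _
  simp only [dif_pos (h d hd)]
  exact Classical.choose_spec (h d hd)

/-- The order is unchanged under an injective base change. [cite: Lazard1955, §I Lemme 1] -/
theorem order_map_of_injective' {P : Type v} {Q : Type w} [CommRing P] [CommRing Q] {τ : Type*} (ι : P →+* Q)
    (hι : Function.Injective ι) (G : MvPowerSeries τ P) : (MvPowerSeries.map ι G).order = G.order := by
  refine le_antisymm ?_ (MvPowerSeries.le_order_map ι)
  refine MvPowerSeries.le_order fun d hd => ?_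
  have := MvPowerSeries.coeff_of_lt_order hd
  rw [MvPowerSeries.coeff_map] at this
  exact hι (by rw [this, map_zero])

/-! ## §2 The descent of bud extensions -/

section Descent

variable [IsDomain 𝒪] [IsDiscreteValuationRing 𝒪] [Finite (IsLocalRing.ResidueField 𝒪)]
variable {P Q : Type v} [CommRing P] [Algebra 𝒪 P] [CommRing Q] [Algebra 𝒪 Q] (ι : P →ₐ[𝒪] Q)

/-- **Descent of bud extensions along an injective base change** (`𝒪` a DVR with finite residue field of characteristic `p`).
If `ι : P → Q` is an injective `𝒪`-algebra map and every `k`-bud over `Q` is congruent `mod deg k+1` to a `(k+1)`-bud, then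
every `k`-bud `(f, r)` over `P` (`k ≥ 1`) is congruent `mod deg k+1` to a `(k+1)`-bud over `P`.
[cite: Lazard1955, §III] [cite: Drinfeld1974, §1 Prop. 1.4 (proof)] -/
theorem IsOModuleBud.exists_extend_of_injective (p : ℕ) [Fact p.Prime] [CharP (IsLocalRing.ResidueField 𝒪) p]
    (hι : Function.Injective ι) {k : ℕ} (hk : 1 ≤ k)
    (hext : ∀ (f : MvPowerSeries (Fin 2) Q) (r : 𝒪 → PowerSeries Q), IsOModuleBud 𝒪 k f r →
      ∃ (F : MvPowerSeries (Fin 2) Q) (ρ : 𝒪 → PowerSeries Q), IsOModuleBud 𝒪 (k + 1) F ρ ∧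
        ((k + 1 : ℕ) : ℕ∞) ≤ (F - f).order ∧ ∀ a, ((k + 1 : ℕ) : ℕ∞) ≤ MvPowerSeries.order (ρ a - r a))
    {f : MvPowerSeries (Fin 2) P} {r : 𝒪 → PowerSeries P} (h : IsOModuleBud 𝒪 k f r) :
    ∃ (F : MvPowerSeries (Fin 2) P) (ρ : 𝒪 → PowerSeries P), IsOModuleBud 𝒪 (k + 1) F ρ ∧
      ((k + 1 : ℕ) : ℕ∞) ≤ (F - f).order ∧ ∀ a, ((k + 1 : ℕ) : ℕ∞) ≤ MvPowerSeries.order (ρ a - r a) := by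
  classical
  have hm : 2 ≤ k + 1 := by omega
  have hιr : Function.Injective ι.toRingHom := hι
  -- 1. base change and extension over `Q`
  have hQ := h.map ι
  obtain ⟨F₀, ρ₀, h₀, hF₀, hρ₀⟩ := hext _ _ hQ
  -- 2. the quotient module `N = Q / ι(P)` and the relations
  set S : Submodule 𝒪 Q := LinearMap.range ι.toLinearMap with hS
  set g : Q →ₗ[𝒪] Q ⧸ S := S.mkQ with hg
  have hg0 : ∀ x : P, g (ι.toRingHom x) = 0 := fun x => by
    rw [hg, Submodule.mkQ_apply, Submodule.Quotient.mk_eq_zero, hS]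
    exact ⟨x, rfl⟩
  have hgker : ∀ y : Q, g y = 0 → y ∈ Set.range ι.toRingHom := fun y hy => by
    rw [hg, Submodule.mkQ_apply, Submodule.Quotient.mk_eq_zero, hS, LinearMap.mem_range] at hy
    obtain ⟨x, hx⟩ := hy
    exact ⟨x, hx⟩
  have rel := IsOModuleBud.isBudRelation_of_sub hm (hQ.mono (by omega)) h₀ hF₀ hρ₀ g
    (fun d _ => by rw [← map_assocDefect _ h.constantCoeff_F, MvPowerSeries.coeff_map]; exact hg0 _)
    (fun d _ => by rw [← map_commDefect, MvPowerSeries.coeff_map]; exact hg0 _)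
    (fun a d _ => by rw [← map_homDefect _ h.constantCoeff_F (h.constantCoeff_ρ a), MvPowerSeries.coeff_map]; exact hg0 _)
    (fun a b => by
      have := map_addDefect ι.toRingHom (F := f) (χ := r (a + b)) (h.constantCoeff_ρ a) (h.constantCoeff_ρ b)
      rw [← this, PowerSeries.coeff_map]; exact hg0 _)
    (fun a b => by
      have := map_mulDefect ι.toRingHom (φ := r a) (χ := r (a * b)) (h.constantCoeff_ρ b)
      rw [← this, PowerSeries.coeff_map]; exact hg0 _)
  -- 3. the Drinfeld cocycle in `N` and its lift to `Q`
  obtain ⟨cN, hcN, hdr⟩ := rel.exists_isDrinfeldCocycle hm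
  obtain ⟨c, δ, hcδ, hgc, hgδ⟩ := IsDrinfeldCocycle.exists_lift p hm g (Submodule.mkQ_surjective S) hdr
  -- 4. subtract the lifted cocycle
  have hneg := (IsDrinfeldCocycle.zero (𝒪 := 𝒪) (N := Q) (k + 1)).sub hcδ
  simp only [zero_sub] at hneg
  have h₁ := h₀.add_cocycle hm hneg
  set F₁ := F₀ + (-c) • lazardSeries Q (k + 1) with hF₁
  set ρ₁ : 𝒪 → PowerSeries Q := fun a => ρ₀ a + (-δ a) • (PowerSeries.X : PowerSeries Q) ^ (k + 1) with hρ₁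
  -- 5. the corrected extension has coefficients in `ι(P)` up to degree `k+1`
  have hLord : ((k + 1 : ℕ) : ℕ∞) ≤ ((-c) • lazardSeries Q (k + 1)).order :=
    le_trans (le_order_lazardSeries (k + 1)) MvPowerSeries.le_order_smul
  have hXord : ∀ a, ((k + 1 : ℕ) : ℕ∞) ≤ MvPowerSeries.order ((-δ a) • (PowerSeries.X : PowerSeries Q) ^ (k + 1)) := fun a =>
    le_trans (natCast_le_order_pow (by change PowerSeries.constantCoeff PowerSeries.X = 0; simp) _) MvPowerSeries.le_order_smul
  have hF₁f : ((k + 1 : ℕ) : ℕ∞) ≤ (F₁ - MvPowerSeries.map ι.toRingHom f).order := by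
    have e : F₁ - MvPowerSeries.map ι.toRingHom f = (F₀ - MvPowerSeries.map ι.toRingHom f) + (-c) • lazardSeries Q (k + 1) := by
      rw [hF₁]; ring
    rw [e]; exact natCast_le_order_add hF₀ hLord
  have hρ₁r : ∀ a, ((k + 1 : ℕ) : ℕ∞) ≤ MvPowerSeries.order (ρ₁ a - PowerSeries.map ι.toRingHom (r a)) := fun a => by
    have e : ρ₁ a - PowerSeries.map ι.toRingHom (r a) = (ρ₀ a - PowerSeries.map ι.toRingHom (r a)) + (-δ a) • PowerSeries.X ^ (k + 1) := by
      simp only [hρ₁]; ring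
    rw [e]; exact natCast_le_order_add (hρ₀ a) (hXord a)
  have hcoefF : ∀ d : Fin 2 →₀ ℕ, d.degree < k + 2 → coeff d (F₁ - MvPowerSeries.map ι.toRingHom f) ∈ Set.range ι.toRingHom := by
    intro d hd
    rcases Nat.lt_or_ge d.degree (k + 1) with hlt | hge
    · exact ⟨0, by rw [map_zero]; exact ((natCast_le_order_iff.1 hF₁f) d hlt).symm⟩
    · have hdeg : d.degree = k + 1 := by omega
      apply hgker
      have hd2 : d = single 0 (d 0) + single 1 (k + 1 - d 0) ∧ d 0 ≤ k + 1 := by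
        rw [degree_eq_sum, Fin.sum_univ_two] at hdeg
        refine ⟨Finsupp.ext fun i => ?_, by omega⟩
        fin_cases i
        · simp
        · simp; omega
      rw [hd2.1, ← degCoeff_of_le _ hd2.2, hF₁, show F₀ + -c • lazardSeries Q (k + 1) - MvPowerSeries.map ι.toRingHom f =
        (F₀ - MvPowerSeries.map ι.toRingHom f) + -c • lazardSeries Q (k + 1) by ring, degCoeff_add, degCoeff_smul_lazardSeries, map_add,
        hcN, smul_neg, map_neg, map_nsmul, hgc, add_neg_cancel]
  have hcoefρ : ∀ (a : 𝒪) (d : Unit →₀ ℕ), d.degree < k + 2 →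
      coeff d (ρ₁ a - PowerSeries.map ι.toRingHom (r a)) ∈ Set.range ι.toRingHom := by
    intro a d hd
    rcases Nat.lt_or_ge d.degree (k + 1) with hlt | hge
    · exact ⟨0, by rw [map_zero]; exact ((natCast_le_order_iff.1 (hρ₁r a)) d hlt).symm⟩
    · have hdeg : d.degree = k + 1 := by omega
      apply hgker
      have hd1 : d = single () (k + 1) := by
        rw [degree_eq_sum, Fintype.sum_unique] at hdeg
        exact Finsupp.ext fun u => by obtain ⟨⟩ := u; simpa using hdeg
      rw [hd1, ← PowerSeries.coeff_def (s := single () (k + 1)) (n := k + 1) (by simp), hρ₁]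
      change g (PowerSeries.coeff (k + 1) (ρ₀ a + -δ a • PowerSeries.X ^ (k + 1) - PowerSeries.map ι.toRingHom (r a))) = 0
      rw [show ρ₀ a + -δ a • PowerSeries.X ^ (k + 1) - PowerSeries.map ι.toRingHom (r a) =
        (ρ₀ a - PowerSeries.map ι.toRingHom (r a)) + -δ a • PowerSeries.X ^ (k + 1) by ring, map_add, map_add, map_smul,
        PowerSeries.coeff_X_pow_self, smul_eq_mul, mul_one, map_neg, hgδ, add_neg_cancel]
  -- 6. descend
  obtain ⟨F, hF⟩ := exists_map_sub_le_order ι.toRingHom _ (k + 2) hcoefF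
  have hρex : ∀ a, ∃ ψ : PowerSeries P, ((k + 2 : ℕ) : ℕ∞) ≤ MvPowerSeries.order (PowerSeries.map ι.toRingHom ψ -
      (ρ₁ a - PowerSeries.map ι.toRingHom (r a))) := fun a => exists_map_sub_le_order ι.toRingHom _ (k + 2) (hcoefρ a)
  choose ψ hψ using hρex
  -- the candidates over `P`: `f + F`, `r a + ψ a`
  have hιF : ((k + 2 : ℕ) : ℕ∞) ≤ (MvPowerSeries.map ι.toRingHom (f + F) - F₁).order := by
    have e : MvPowerSeries.map ι.toRingHom (f + F) - F₁ = MvPowerSeries.map ι.toRingHom F - (F₁ - MvPowerSeries.map ι.toRingHom f) := by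
      rw [map_add]; ring
    rw [e]; exact hF
  have hιρ : ∀ a, ((k + 2 : ℕ) : ℕ∞) ≤ MvPowerSeries.order (PowerSeries.map ι.toRingHom (r a + ψ a) - ρ₁ a) := fun a => by
    have e : PowerSeries.map ι.toRingHom (r a + ψ a) - ρ₁ a = PowerSeries.map ι.toRingHom (ψ a) - (ρ₁ a - PowerSeries.map ι.toRingHom (r a)) := by
      rw [map_add]; ring
    rw [e]; exact hψ a
  -- 7. `(ι(f+F), ι(r+ψ))` is a `(k+1)`-bud over `Q` (congruent to `(F₁, ρ₁)`), hence `(f+F, r+ψ)` is one over `P`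
  have hc0F : MvPowerSeries.constantCoeff (MvPowerSeries.map ι.toRingHom (f + F)) = 0 := by
    have := (natCast_le_order_sub_iff.1 hιF) 0 (by simp)
    rw [MvPowerSeries.coeff_zero_eq_constantCoeff_apply, MvPowerSeries.coeff_zero_eq_constantCoeff_apply] at this
    rw [this]; exact h₁.constantCoeff_F
  have hc0ρ : ∀ a, PowerSeries.constantCoeff (PowerSeries.map ι.toRingHom (r a + ψ a)) = 0 := fun a => by
    have := (natCast_le_order_sub_iff.1 (hιρ a)) 0 (by simp)
    rw [MvPowerSeries.coeff_zero_eq_constantCoeff_apply, MvPowerSeries.coeff_zero_eq_constantCoeff_apply] at this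
    exact this.trans (h₁.constantCoeff_ρ a)
  have hc1ρ : ∀ a, PowerSeries.coeff 1 (PowerSeries.map ι.toRingHom (r a + ψ a)) = algebraMap 𝒪 Q a := fun a => by
    have := (natCast_le_order_sub_iff.1 (hιρ a)) (single () 1) (by simp)
    rw [← PowerSeries.coeff_def (s := single () 1) (n := 1) (by simp)] at this
    exact this.trans (h₁.coeff_one_ρ a)
  have hbudQ : IsOModuleBud 𝒪 (k + 1) (MvPowerSeries.map ι.toRingHom (f + F)) (fun a => PowerSeries.map ι.toRingHom (r a + ψ a)) :=
    h₁.congr (by omega) hc0F hc0ρ hιF hιρ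
  have hbudP : IsOModuleBud 𝒪 (k + 1) (f + F) (fun a => r a + ψ a) := by
    refine IsOModuleBud.of_map_injective ι hι ?_ (fun a => ?_) (fun a => ?_) hbudQ
    · apply hιr; rw [map_zero, ← MvPowerSeries.constantCoeff_map]; exact hc0F
    · apply hιr
      rw [map_zero, ← PowerSeries.coeff_zero_eq_constantCoeff_apply, ← PowerSeries.coeff_map,
        PowerSeries.coeff_zero_eq_constantCoeff_apply]
      exact hc0ρ a
    · apply hιr
      rw [← PowerSeries.coeff_map]
      exact (hc1ρ a).trans (ι.commutes a).symm
  refine ⟨f + F, fun a => r a + ψ a, hbudP, ?_, fun a => ?_⟩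
  · rw [add_sub_cancel_left, ← order_map_of_injective' ι.toRingHom hιr]
    have e : MvPowerSeries.map ι.toRingHom F = (MvPowerSeries.map ι.toRingHom (f + F) - F₁) + (F₁ - MvPowerSeries.map ι.toRingHom f) := by
      rw [map_add]; ring
    rw [e]; exact natCast_le_order_add (natCast_le_order_of_le hιF (by omega)) hF₁f
  · rw [add_sub_cancel_left, ← order_map_of_injective' (τ := Unit) ι.toRingHom hιr]
    have e : (MvPowerSeries.map ι.toRingHom (ψ a) : MvPowerSeries Unit Q) =
        (PowerSeries.map ι.toRingHom (r a + ψ a) - ρ₁ a) + (ρ₁ a - PowerSeries.map ι.toRingHom (r a)) := by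
      change PowerSeries.map ι.toRingHom (ψ a) = _
      rw [map_add]; ring
    rw [e]; exact natCast_le_order_add (natCast_le_order_of_le (hιρ a) (by omega)) (hρ₁r a)

end Descent

end Literature.RingTheory.FormalGroups
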